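import Mathlib
import HarnessLib
import Summits.NavierStokesRegularity.NavierStokesRegularity.Theorems.UnthreadedDoorAntidynamoWallAccumulating

/-!
# Route `UnthreadedDoor` / `ThreadingFlux`, crux `PoloidalLiouville` (stmt-NavierStokesRegularity-1222), antidynamo v2 skeleton
# (sha16 `4ebf5683127b`), WALL `stub_scalarLiouville`: LOCAL CLOSERS — an orthogonal direction, or a second centre, ON AN OPEN SET at
# times accumulating at one negative instant closes the wall

Support file (seat leafhand-ns-unthreadeddoor-2 g1, cell decomp-ns), `--supports stmt-NavierStokesRegularity-1222 --as helper`; theorems only.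

The level-set mechanisms proposed for the wall (the (2a′)/(2b) programme of the skeleton, the cell-flux and indicatrix lines) are LOCAL in space:
they work on a patch of a sphere, on a component of `{ω ≠ 0}`, near the centre.  The accumulation closer of p816144 wants a direction orthogonal to
the WHOLE vorticity slice.  This file closes the gap: in the analytic frame of `CellFlux.unthreadedAnalyticOrIrrotational` the slice
`x ↦ ⟪e, curl v(t, x)⟫` is real-analytic on `ℝ³`, so orthogonality ON A NON-EMPTY OPEN SET is orthogonality everywhere.

* `analyticOnNhd_inner_const_curl` — in an analytic frame, `x ↦ ⟪e, curl v(t, x)⟫` is real-analytic on `ℝ³` (`t < 0`).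
* ★★ `curl_eq_zero_of_local_orthogonal_direction_frequently` — unthreaded about `x₀` + at times accumulating at some `t₀ < 0` a non-zero `e` and
  a non-empty open `U` with `⟪e, curl v(t, x)⟫ = 0` for `x ∈ U` ⇒ `curl v ≡ 0` on `(−∞,0) × ℝ³`; `constant_…`.
* ★★ `curl_eq_zero_of_local_second_centre_frequently` — unthreaded about `x₀` + at times accumulating at some `t₀ < 0` a second centre
  `x₁ ≠ x₀` (possibly DIFFERENT at different times) about which the vorticity is tangent to the spheres ON A NON-EMPTY OPEN SET ⇒ `curl v ≡ 0`.
* ★★ `stubScalarLiouville_of_local_zonal_frequently` — the wall's letter: if at times accumulating at some `t₀ < 0` the toroidal potential is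
  ZONAL ON AN OPEN SET (`⟪e, ∇T(t,x) × (x − x₀)⟫ = 0` for `x ∈ U`: `T(t,·)` is invariant there under the rotations about the axis `x₀ + ℝe`,
  the axis may depend on the time), then `∇T × (x − x₀) ≡ 0` on `(−∞,0) × ℝ³`.

MEANING FOR THE WALL (repair census): a line closes the wall as soon as it manufactures, on ANY open spatial patch and at ANY set of times
accumulating at a finite negative instant, a direction orthogonal to the vorticity (local zonality of `T`) or a second centre of tangency.
HONEST LABEL: corollaries of Σ-5a + Z + the identity theorem; nothing here proves `stub_scalarLiouville`, `PoloidalLiouville` (1222), or bears on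
Navier–Stokes regularity; no summit statement is proved (crux 1222 is INCOMPARABLE with the summit). [folklore]
[cite: KochNadirashviliSereginSverak2009, Thm 5.2 (arXiv:0709.3599 pp. 9–10); LemarieRieusset2016, Thm. 9.12]
-/

noncomputable section

-- the summit and its single sub-problem share the name (CONVENTIONS §1)
set_option linter.dupNamespace false

open scoped Topology InnerProductSpace RealInnerProductSpace ContDiff
open Filter Set Function Metric MeasureTheory
open Literature.Analysis.FluidPDE

namespace Summit.NavierStokesRegularity.NavierStokesRegularity.Theorems.PoloidalLiouville.Antidynamo

open Summit.NavierStokesRegularity.NavierStokesRegularity.Theorems.PoloidalLiouville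
  (toroidalPotential exists_norm_curl_le constantOfIrrotational)

/-! ### Analytic slices -/

/-- In an analytic frame the scalar slice `x ↦ ⟪e, curl v(t, x)⟫` is real-analytic on `ℝ³` for every `t < 0`. [folklore] -/
theorem analyticOnNhd_inner_const_curl {v : ℝ → EuclideanSpace ℝ (Fin 3) → EuclideanSpace ℝ (Fin 3)}
    (hA : AnalyticOnNhd ℝ (Function.uncurry v) (Iio (0 : ℝ) ×ˢ (univ : Set (EuclideanSpace ℝ (Fin 3)))))
    (e : EuclideanSpace ℝ (Fin 3)) {t : ℝ} (ht : t < 0) :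
    AnalyticOnNhd ℝ (fun x : EuclideanSpace ℝ (Fin 3) => ⟪e, curl (v t) x⟫) univ := by
  have hω := CellFlux.analyticOnNhd_curl_uncurry hA
  intro x _
  have hx : AnalyticAt ℝ (fun y : EuclideanSpace ℝ (Fin 3) => curl (v t) y) x :=
    (hω (t, x) ⟨ht, mem_univ _⟩).comp₂ analyticAt_const analyticAt_id
  have h := ((innerSL ℝ e).analyticAt (curl (v t) x)).comp hx
  exact h.congr (Eventually.of_forall fun y => by simp [Function.comp])

/-- In an analytic frame, orthogonality to `e` on a non-empty open set is orthogonality everywhere (identity theorem on the preconnected `ℝ³`).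
[folklore] -/
theorem inner_curl_eq_zero_of_eq_zero_on_open {v : ℝ → EuclideanSpace ℝ (Fin 3) → EuclideanSpace ℝ (Fin 3)}
    (hA : AnalyticOnNhd ℝ (Function.uncurry v) (Iio (0 : ℝ) ×ˢ (univ : Set (EuclideanSpace ℝ (Fin 3)))))
    (e : EuclideanSpace ℝ (Fin 3)) {t : ℝ} (ht : t < 0) {U : Set (EuclideanSpace ℝ (Fin 3))} (hUo : IsOpen U)
    (hUne : U.Nonempty) (hU : ∀ x ∈ U, ⟪e, curl (v t) x⟫ = 0) (x : EuclideanSpace ℝ (Fin 3)) :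
    ⟪e, curl (v t) x⟫ = 0 := by
  obtain ⟨x₁, hx₁⟩ := hUne
  have hUn : U ∈ 𝓝 x₁ := hUo.mem_nhds hx₁
  have hev : (fun y : EuclideanSpace ℝ (Fin 3) => ⟪e, curl (v t) y⟫) =ᶠ[𝓝 x₁] 0 :=
    Filter.eventually_of_mem hUn fun y hy => hU y hy
  exact (analyticOnNhd_inner_const_curl hA e ht).eqOn_zero_of_preconnected_of_eventuallyEq_zero isPreconnected_univ
    (mem_univ x₁) hev (mem_univ x)

/-! ### ★★ Local orthogonal directions at accumulating times -/

/-- ★★ **A LOCAL ORTHOGONAL DIRECTION AT ACCUMULATING TIMES ⇒ IRROTATIONAL.**  Let `v` be a bounded ancient mild solution (`ν = 1`, duality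
class) with measurable slices, jointly smooth on `(−∞,0) × ℝ³` and unthreaded about `x₀`.  If for some `t₀ < 0` there are, at times accumulating
at `t₀`, a non-zero direction `e` and a non-empty open set `U` with `⟪e, curl v(t, x)⟫ = 0` for all `x ∈ U`, then `curl v ≡ 0` on
`(−∞,0) × ℝ³`.  [Analytic-or-irrotational; in the analytic frame the local orthogonality is global (`inner_curl_eq_zero_of_eq_zero_on_open`);
accumulation closer p816144.] [cite: KochNadirashviliSereginSverak2009, Thm 5.2 (arXiv:0709.3599 pp. 9–10); LemarieRieusset2016, Thm. 9.12] -/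
theorem curl_eq_zero_of_local_orthogonal_direction_frequently
    (v : ℝ → EuclideanSpace ℝ (Fin 3) → EuclideanSpace ℝ (Fin 3)) (x₀ : EuclideanSpace ℝ (Fin 3))
    (hB : Literature.Analysis.FluidPDE.IsBoundedAncientMildSolution 1 v)
    (hm : ∀ t < 0, AEStronglyMeasurable (v t) volume)
    (hsm : ContDiffOn ℝ (⊤ : ℕ∞) (Function.uncurry v) (Set.Iio 0 ×ˢ Set.univ))
    (hun : ∀ t < 0, ∀ x, ⟪x - x₀, curl (v t) x⟫ = 0)
    (hdir : ∃ t₀ < 0, ∃ᶠ t in 𝓝[≠] t₀, ∃ e : EuclideanSpace ℝ (Fin 3), e ≠ 0 ∧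
      ∃ U : Set (EuclideanSpace ℝ (Fin 3)), IsOpen U ∧ U.Nonempty ∧ ∀ x ∈ U, ⟪e, curl (v t) x⟫ = 0) :
    ∀ t < 0, ∀ x, curl (v t) x = 0 := by
  obtain ⟨K, hK⟩ := exists_norm_curl_le hB hsm
  obtain ⟨T, -, -, hlink⟩ := toroidalPotential v x₀ K hsm hK hun
  rcases CellFlux.unthreadedAnalyticOrIrrotational v x₀ T hB hm hsm hlink with hA | hZ
  · obtain ⟨t₀, ht₀, hfr⟩ := hdir
    have hneg0 : ∀ᶠ t in 𝓝 t₀, t < 0 := Iio_mem_nhds ht₀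
    have hneg : ∀ᶠ t in 𝓝[≠] t₀, t < 0 := hneg0.filter_mono nhdsWithin_le_nhds
    refine curl_eq_zero_of_orthogonal_direction_frequently v x₀ hB hm hsm hun ⟨t₀, ht₀, ?_⟩
    exact (hfr.and_eventually hneg).mono fun t ⟨⟨e, he, U, hUo, hUne, hU⟩, ht⟩ =>
      ⟨e, he, inner_curl_eq_zero_of_eq_zero_on_open hA e ht hUo hUne hU⟩
  · exact hZ

/-- ★★ **… HENCE SLICE-WISE CONSTANT.** [cite: KochNadirashviliSereginSverak2009, Thm 5.2 (arXiv:0709.3599 pp. 9–10)] -/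
theorem constant_of_local_orthogonal_direction_frequently
    (v : ℝ → EuclideanSpace ℝ (Fin 3) → EuclideanSpace ℝ (Fin 3)) (x₀ : EuclideanSpace ℝ (Fin 3))
    (hB : Literature.Analysis.FluidPDE.IsBoundedAncientMildSolution 1 v)
    (hm : ∀ t < 0, AEStronglyMeasurable (v t) volume)
    (hsm : ContDiffOn ℝ (⊤ : ℕ∞) (Function.uncurry v) (Set.Iio 0 ×ˢ Set.univ))
    (hun : ∀ t < 0, ∀ x, ⟪x - x₀, curl (v t) x⟫ = 0)
    (hdir : ∃ t₀ < 0, ∃ᶠ t in 𝓝[≠] t₀, ∃ e : EuclideanSpace ℝ (Fin 3), e ≠ 0 ∧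
      ∃ U : Set (EuclideanSpace ℝ (Fin 3)), IsOpen U ∧ U.Nonempty ∧ ∀ x ∈ U, ⟪e, curl (v t) x⟫ = 0) :
    ∀ t < 0, ∃ c : EuclideanSpace ℝ (Fin 3), ∀ x, v t x = c :=
  constantOfIrrotational v hB hsm (curl_eq_zero_of_local_orthogonal_direction_frequently v x₀ hB hm hsm hun hdir)

/-! ### ★★ A local second centre at accumulating times -/

/-- ★★ **A LOCAL, POSSIBLY MOVING, SECOND CENTRE AT ACCUMULATING TIMES ⇒ IRROTATIONAL.**  Let `v` be as above, unthreaded about `x₀` at every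
`t < 0`.  If at times `t` accumulating at some `t₀ < 0` there are a point `x₁ ≠ x₀` (allowed to depend on `t`) and a non-empty open set `U` with
`⟪x − x₁, curl v(t, x)⟫ = 0` for all `x ∈ U`, then `curl v ≡ 0` on `(−∞,0) × ℝ³` (`x₁ − x₀` is a local orthogonal direction).
[cite: KochNadirashviliSereginSverak2009, Thm 5.2 (arXiv:0709.3599 pp. 9–10)] -/
theorem curl_eq_zero_of_local_second_centre_frequently
    (v : ℝ → EuclideanSpace ℝ (Fin 3) → EuclideanSpace ℝ (Fin 3)) (x₀ : EuclideanSpace ℝ (Fin 3))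
    (hB : Literature.Analysis.FluidPDE.IsBoundedAncientMildSolution 1 v)
    (hm : ∀ t < 0, AEStronglyMeasurable (v t) volume)
    (hsm : ContDiffOn ℝ (⊤ : ℕ∞) (Function.uncurry v) (Set.Iio 0 ×ˢ Set.univ))
    (hun : ∀ t < 0, ∀ x, ⟪x - x₀, curl (v t) x⟫ = 0)
    (hun₁ : ∃ t₀ < 0, ∃ᶠ t in 𝓝[≠] t₀, ∃ x₁ : EuclideanSpace ℝ (Fin 3), x₁ ≠ x₀ ∧
      ∃ U : Set (EuclideanSpace ℝ (Fin 3)), IsOpen U ∧ U.Nonempty ∧ ∀ x ∈ U, ⟪x - x₁, curl (v t) x⟫ = 0) :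
    ∀ t < 0, ∀ x, curl (v t) x = 0 := by
  obtain ⟨t₀, ht₀, hfr⟩ := hun₁
  have hneg0 : ∀ᶠ t in 𝓝 t₀, t < 0 := Iio_mem_nhds ht₀
  have hneg : ∀ᶠ t in 𝓝[≠] t₀, t < 0 := hneg0.filter_mono nhdsWithin_le_nhds
  refine curl_eq_zero_of_local_orthogonal_direction_frequently v x₀ hB hm hsm hun ⟨t₀, ht₀, ?_⟩
  refine (hfr.and_eventually hneg).mono fun t ⟨⟨x₁, hx, U, hUo, hUne, hU⟩, ht⟩ =>
    ⟨x₁ - x₀, sub_ne_zero.2 hx, U, hUo, hUne, fun x hxU => ?_⟩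
  have h0 := hun t ht x
  have e : x₁ - x₀ = (x - x₀) - (x - x₁) := by abel
  rw [e, inner_sub_left, h0, hU x hxU, sub_zero]

/-- ★★ **… HENCE SLICE-WISE CONSTANT.** [cite: KochNadirashviliSereginSverak2009, Thm 5.2 (arXiv:0709.3599 pp. 9–10)] -/
theorem constant_of_local_second_centre_frequently
    (v : ℝ → EuclideanSpace ℝ (Fin 3) → EuclideanSpace ℝ (Fin 3)) (x₀ : EuclideanSpace ℝ (Fin 3))
    (hB : Literature.Analysis.FluidPDE.IsBoundedAncientMildSolution 1 v)
    (hm : ∀ t < 0, AEStronglyMeasurable (v t) volume)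
    (hsm : ContDiffOn ℝ (⊤ : ℕ∞) (Function.uncurry v) (Set.Iio 0 ×ˢ Set.univ))
    (hun : ∀ t < 0, ∀ x, ⟪x - x₀, curl (v t) x⟫ = 0)
    (hun₁ : ∃ t₀ < 0, ∃ᶠ t in 𝓝[≠] t₀, ∃ x₁ : EuclideanSpace ℝ (Fin 3), x₁ ≠ x₀ ∧
      ∃ U : Set (EuclideanSpace ℝ (Fin 3)), IsOpen U ∧ U.Nonempty ∧ ∀ x ∈ U, ⟪x - x₁, curl (v t) x⟫ = 0) :
    ∀ t < 0, ∃ c : EuclideanSpace ℝ (Fin 3), ∀ x, v t x = c :=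
  constantOfIrrotational v hB hsm (curl_eq_zero_of_local_second_centre_frequently v x₀ hB hm hsm hun hun₁)

/-! ### ★★ The wall's letter: local zonality at accumulating times -/

/-- ★★ **THE WALL'S LETTER: LOCAL ZONALITY OF THE POTENTIAL AT ACCUMULATING TIMES ⇒ TRIVIAL.**  If the vorticity of the wall's flow is
`∇T(t,·) × (· − x₀)` and at times accumulating at some `t₀ < 0` there are a non-zero axis `e` and a non-empty open set `U` on which
`⟪e, ∇T(t,x) × (x − x₀)⟫ = 0` (the derivative of `T(t,·)` along the rotation field `e × (x − x₀)` vanishes on `U`: `T(t,·)` is locally zonal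
about the axis `x₀ + ℝe`; the axis may depend on the time), then `∇T × (x − x₀) ≡ 0` on `(−∞,0) × ℝ³`.
[cite: KochNadirashviliSereginSverak2009, Thm 5.2 (arXiv:0709.3599 pp. 9–10)] -/
theorem stubScalarLiouville_of_local_zonal_frequently
    (v : ℝ → EuclideanSpace ℝ (Fin 3) → EuclideanSpace ℝ (Fin 3)) (x₀ : EuclideanSpace ℝ (Fin 3))
    (T : ℝ → EuclideanSpace ℝ (Fin 3) → ℝ)
    (hB : Literature.Analysis.FluidPDE.IsBoundedAncientMildSolution 1 v)
    (hm : ∀ t < 0, AEStronglyMeasurable (v t) volume)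
    (hsm : ContDiffOn ℝ (⊤ : ℕ∞) (Function.uncurry v) (Set.Iio 0 ×ˢ Set.univ))
    (hrep : ∀ t < 0, ∀ x, Literature.Analysis.FluidPDE.curl (v t) x =
      Literature.Analysis.FluidPDE.cross (gradient (T t) x) (x - x₀))
    (hdir : ∃ t₀ < 0, ∃ᶠ t in 𝓝[≠] t₀, ∃ e : EuclideanSpace ℝ (Fin 3), e ≠ 0 ∧
      ∃ U : Set (EuclideanSpace ℝ (Fin 3)), IsOpen U ∧ U.Nonempty ∧
        ∀ x ∈ U, ⟪e, Literature.Analysis.FluidPDE.cross (gradient (T t) x) (x - x₀)⟫ = 0) :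
    ∀ t < 0, ∀ x, Literature.Analysis.FluidPDE.cross (gradient (T t) x) (x - x₀) = 0 := by
  have hun : ∀ t < 0, ∀ x, ⟪x - x₀, curl (v t) x⟫ = 0 := fun t ht x => by
    rw [hrep t ht x]
    simp [cross, crossProduct, PiLp.inner_apply, Fin.sum_univ_three]
    ring
  obtain ⟨t₀, ht₀, hfr⟩ := hdir
  have hneg0 : ∀ᶠ t in 𝓝 t₀, t < 0 := Iio_mem_nhds ht₀
  have hneg : ∀ᶠ t in 𝓝[≠] t₀, t < 0 := hneg0.filter_mono nhdsWithin_le_nhds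
  have hfr' : ∃ᶠ t in 𝓝[≠] t₀, ∃ e : EuclideanSpace ℝ (Fin 3), e ≠ 0 ∧
      ∃ U : Set (EuclideanSpace ℝ (Fin 3)), IsOpen U ∧ U.Nonempty ∧ ∀ x ∈ U, ⟪e, curl (v t) x⟫ = 0 :=
    (hfr.and_eventually hneg).mono fun t ⟨⟨e, he, U, hUo, hUne, hU⟩, ht⟩ =>
      ⟨e, he, U, hUo, hUne, fun x hx => by rw [hrep t ht x]; exact hU x hx⟩
  intro t ht x
  rw [← hrep t ht x]
  exact curl_eq_zero_of_local_orthogonal_direction_frequently v x₀ hB hm hsm hun ⟨t₀, ht₀, hfr'⟩ t ht x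

end Summit.NavierStokesRegularity.NavierStokesRegularity.Theorems.PoloidalLiouville.Antidynamo

end
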